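import Summits.ValiantsHypothesis.ValiantsHypothesis.Theorems.LacunarySymmetroidMatrixDescartesDoorA26WallBubblingSecondOrderDiscriminant

/-!
# `DoorA26` / line `wall_bubbling` — PRESCRIBING THE FIRST VARIATION AT SIX POINTS (the hypothesis `hT3` of the discriminant form)

HONEST FRAMING.  Object-search cell `pub-symmetroid`, crux `Theses.LacunarySymmetroid.DoorA26` (stmt-ValiantsHypothesis-19979; OPEN, typed,
never asserted).  W2 seat val-sym-door-p1 g20, file #89; def-free helper for obligation (R) of `Cruxes/DoorA26/Lines/wall_bubbling.lean`.
Imports #88 `…SecondOrderDiscriminant` (for the currency) — uses #45 `exists_expSum_interpolate` (exponential interpolation at six abscissae).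

WHAT IS HERE.  `pol_smul_one_fin_two` (`pol(X, φ·1) = φ·tr X` for `2 × 2` matrices), ★ `exists_thirdShift_values`: with injective exponents, six
distinct abscissae `u` containing the selected points `z_j` (`m_j = 3`) through an injective slot map, and `tr P(z_j) ≠ 0` there (rank-one points),
every family of values `v_j` is `pol(P(z_j), Q₃(z_j))` for the SCALAR shift `T₃ l = c_l·1` — discharging the hypothesis `hT3` of #88
`mem_twentyLocus_of_secondOrder_discriminant` for rank-one triple zeros (at most six of them in a multiplicity-20 profile).  Nothing here bears on
`DoorA26`, `DoorA34`, (W)/(M)/(R), `MatrixDescartes` (18050) or `VP ≠ VNP`; registers unchanged.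

[folklore] exponential interpolation.  [this work] the packaging.
-/

set_option linter.dupNamespace false

namespace Summit.ValiantsHypothesis.ValiantsHypothesis.Theorems.LacunarySymmetroidMatrixDescartes.WallBubbling

open Finset Filter Topology

/-- `pol(X, φ·1) = det(X + φ·1) − det X − det(φ·1) = φ·tr X` for `2 × 2` matrices. [folklore] -/
theorem pol_smul_one_fin_two (X : Matrix (Fin 2) (Fin 2) ℝ) (φ : ℝ) :
    (X + φ • (1 : Matrix (Fin 2) (Fin 2) ℝ)).det - X.det - (φ • (1 : Matrix (Fin 2) (Fin 2) ℝ)).det = φ * X.trace := by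
  simp only [Matrix.det_fin_two, Matrix.trace_fin_two, Matrix.add_apply, Matrix.smul_apply, Matrix.one_apply_eq,
    Matrix.one_apply_ne (show (0 : Fin 2) ≠ 1 by decide), Matrix.one_apply_ne (show (1 : Fin 2) ≠ 0 by decide), smul_eq_mul, mul_one, mul_zero]
  ring

/-- The pencil of scalar letters `c_l·1` is `φ(t)·1`, `φ = Σ_l c_l e^{δ_l t}`. [folklore] -/
theorem expPencil_smul_one (δ : Fin 6 → ℝ) (c : Fin 6 → ℝ) (t : ℝ) :
    (∑ l, Real.exp (δ l * t) • (c l • (1 : Matrix (Fin 2) (Fin 2) ℝ))) = (∑ l, c l * Real.exp (δ l * t)) • (1 : Matrix (Fin 2) (Fin 2) ℝ) := by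
  rw [Finset.sum_smul]
  exact Finset.sum_congr rfl fun l _ => by rw [smul_smul, mul_comm]

/-- ★ **Prescribing the first variation at the selected points by a scalar shift.**  Injective exponents, six distinct abscissae `u`, an injective slot
map sending every selected index (`m_j = 3`) to an abscissa `u (slot j) = z_j`, and `tr P(z_j) ≠ 0` at the selected points ⇒ for every `v` there is a
symmetric (scalar) shift `T₃` with `pol(P(z_j), Q₃(z_j)) = v_j` at every selected point. [this work] -/
theorem exists_thirdShift_values (δ : Fin 6 → ℝ) (hδ : Function.Injective δ) (S : Fin 6 → Matrix (Fin 2) (Fin 2) ℝ)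
    {r : ℕ} (z : Fin r → ℝ) (m : Fin r → ℕ) (u : Fin 6 → ℝ) (hu : Function.Injective u) (slot : Fin r → Fin 6)
    (hslot : ∀ j, m j = 3 → u (slot j) = z j) (hslot_inj : ∀ j j', m j = 3 → m j' = 3 → slot j = slot j' → j = j')
    (htr : ∀ j, m j = 3 → (∑ l, Real.exp (δ l * z j) • S l).trace ≠ 0) (v : Fin r → ℝ) :
    ∃ T₃ : Fin 6 → Matrix (Fin 2) (Fin 2) ℝ, (∀ l, (T₃ l).IsSymm) ∧
      ∀ j, m j = 3 → ((∑ l, Real.exp (δ l * z j) • S l) + (∑ l, Real.exp (δ l * z j) • T₃ l)).det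
        - (∑ l, Real.exp (δ l * z j) • S l).det - (∑ l, Real.exp (δ l * z j) • T₃ l).det = v j := by
  classical
  -- target values at the six abscissae
  let w : Fin 6 → ℝ := fun a =>
    if h : ∃ j, m j = 3 ∧ slot j = a then v (Classical.choose h) / (∑ l, Real.exp (δ l * z (Classical.choose h)) • S l).trace else 0
  have hw : ∀ j, m j = 3 → w (slot j) = v j / (∑ l, Real.exp (δ l * z j) • S l).trace := by
    intro j hj
    have hex : ∃ j', m j' = 3 ∧ slot j' = slot j := ⟨j, hj, rfl⟩
    have hsel : Classical.choose hex = j :=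
      hslot_inj _ _ (Classical.choose_spec hex).1 hj (Classical.choose_spec hex).2
    simp only [w, dif_pos hex, hsel]
  obtain ⟨c, hc⟩ := exists_expSum_interpolate δ hδ u hu w
  refine ⟨fun l => c l • (1 : Matrix (Fin 2) (Fin 2) ℝ), fun l => (Matrix.isSymm_one).smul (c l), fun j hj => ?_⟩
  rw [expPencil_smul_one, pol_smul_one_fin_two]
  have hφ : (∑ l, c l * Real.exp (δ l * z j)) = v j / (∑ l, Real.exp (δ l * z j) • S l).trace := by
    rw [← hslot j hj, hc (slot j), hw j hj, hslot j hj]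
  rw [hφ, div_mul_cancel₀ _ (htr j hj)]

end Summit.ValiantsHypothesis.ValiantsHypothesis.Theorems.LacunarySymmetroidMatrixDescartes.WallBubbling
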